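import Summits.BirchSwinnertonDyer.BirchSwinnertonDyer.Theorems.GenusKolyvaginAtTwoGenusPrimitiveSupplyAtTwoPosDiscShallowKFourPosHalvingDescent
import HarnessLib

/-!
# Route `GenusKolyvaginAtTwo`, crux K₄⁺ `K4Pos` (stmt-BirchSwinnertonDyer-31469; sign-free, so also K₄ `K4Neg` 31526) —
# THE HALVING DESCENT «B2Q♭», COROLLARIES: every level, the supply discharged, the multiplicative cut, THE K4Pos / K4Neg SHAPE,
# the contrapositive `2^{M₀−1} · Sel_(2^M)(E/ℚ) = 0`, and the `Ш(E/ℚ)` form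

Width seat `bsd-line-gk2-p5` g36 (cell `bsd-f1-sign2`), `--supports stmt-BirchSwinnertonDyer-31469 --as helper`.  THEOREMS ONLY
(no definition, no named fact, no `sorry`).  **BSD is NOT proved by this file; K4Pos / K4Neg are NOT proved; nothing is closed.**

From the core theorem of `…KFourPosHalvingDescent` (modulo Q2, (NPh_K), `hPair`): (i) every level `M` (move `s₀` up along the injective
change of level); (ii) `hPair` discharged by the tree theorem `regularPairSupply_of_heegner`; (iii) (NPh_K) discharged on the multiplicative cut
(`NonPhantomPow.nonPhantomAtTwo_of_hasMultiplicativeReductionAt`); (iv) **`kFourPos_shape_of_two_pow_pred_smul_ne_zero`: the CONCLUSION of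
the route items K4Pos / K4Neg in their own shape (`∃ n` square-free, `∃ d`, every `ℓ ∣ n` a Zhang–Kolyvagin prime at `2` of index `≥ 2` with an
arithmetic Frobenius moving a point of `E[2]`, `P(n) ∉ 2E(K[n])`) from ONE class of `Sel_(2^M)(E/ℚ)` not killed by `2^{M₀−1}`**; (v) the
contrapositive B2Q♭ `two_pow_pred_smul_selmer_rat_eq_zero_of_forall_two_dvd`; (vi) the `Ш(E/ℚ)` form.  READING for the planner-of-record:
modulo Q2 on the cut, K4Pos ⟸ «`Sel_(2^∞)(E/ℚ)` (`= Ш(E/ℚ)[2^∞]`-part on the rank-`0` cell) has exponent EXACTLY `2^{M₀}`» — Kolyvagin's B₂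
over `ℚ` SHARP for `E`, a statement with no Kolyvagin prime and no derived point in it (the converse is the landed exactness
`KolyvaginExactAtTwoPosDiscT` + the ℚ-side reading of gk2-p4 g27/g28).  BSD is NOT proved by any of this.

References: [McCallumLMS1991] §5 Lemma 5.3, Thm. 5.4; [Kolyvagin1989Izv] Thm. B₂, §3; [SilvermanAEC2009] X Thm. 4.2 (a); [LawsonWuthrich2016] §7.1.
-/

set_option autoImplicit false
-- the Theorems namespace of this sub repeats the summit name by design (D-0017 nested layout)
set_option linter.dupNamespace false

noncomputable section

open scoped Classical
open scoped AddSubgroup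

namespace Summit.BirchSwinnertonDyer.BirchSwinnertonDyer.Theorems.GenusExact.PlusDescent

open WeierstrassCurve NumberField IsDedekindDomain Field Rat.HeightOneSpectrum Literature.NumberTheory.EllipticCurves
  Literature.NumberTheory.GaloisRepresentations Literature.NumberTheory.EllipticCurves.ModularForms AddSubgroup
  Literature.NumberTheory.EllipticCurves.RingClassField
open Literature.NumberTheory.EllipticCurves.KolyvaginCocycle
open Summit.BirchSwinnertonDyer.BirchSwinnertonDyer.Theses.GenusKolyvaginAtTwo (KolyvaginRelationAtTwo)
open Summit.BirchSwinnertonDyer.Rank1Residual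
open Summit.BirchSwinnertonDyer.BirchSwinnertonDyer.Theorems.GenusExact
open Summit.BirchSwinnertonDyer.BirchSwinnertonDyer.Theorems.GenusExact.VisiblePairAtTwo
  (liesOver_of_natCast_mem natCast_mem_primesEquiv_symm natCast_prime_mem_iff_eq hasGoodReductionAt_of_hasGoodReductionAtPrime
    not_mem_range intCast_notMem_of_not_dvd)
open Summit.BirchSwinnertonDyer.BirchSwinnertonDyer.Theorems.OffBigImageOddLocalAtTwo


/-! ## §4 Corollaries: every level `M`; `hPair` discharged; the multiplicative cut; the K4Pos / K4Neg shape; the contrapositive B2Q♭ -/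

/-- **B2Q♭ at EVERY level `M`** (master form): the restriction `M ≥ M₀ + 1` of the core theorem removed by moving `s₀` up to level
`2^{M+M₀+1}` along the injective change of level (`E(ℚ)[2] = 0`); the produced prime has index `≥ 2` and an involution of `E[2]` moving a point.
BSD is NOT proved by this. [cite: McCallumLMS1991, §5 Lemma 5.3, Thm. 5.4] [cite: Kolyvagin1989Izv, Thm. B₂] -/
theorem exists_transpositionDeep_primitive_of_two_pow_pred_smul_ne_zero_of_nonPhantom_of_regularPairSupply'
    (hQ2 : KolyvaginRelationAtTwo)
    (W : WeierstrassCurve ℚ) [W.IsElliptic] [W.IsGloballyMinimal] [NeZero (W.conductorNorm ℤ)] (hcm : ¬ W.HasCM)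
    (hT : Odd W.tamagawaProduct)
    (K : Type) [Field K] [NumberField K] (hIQ : IsImaginaryQuadratic K) (hodd : Odd (NumberField.discr K))
    (h3 : NumberField.discr K ≠ -3) (hHe : SatisfiesHeegnerHypothesis (W.conductorNorm ℤ) K)
    (hρ : ∀ n : ℕ, 0 < n → W.HasSurjectiveModNGaloisRep ((2 : ℤ) ^ n))
    (hNPh : ∀ (L : ℕ), 1 ≤ L → ∀ z : galH1Torsion (W.baseChange K) ((2 ^ L : ℕ) : ℤ),
      (∀ ρ' ∈ torsionFixing (W.baseChange K) ((2 ^ L : ℕ) : ℤ), h1Eval (W.baseChange K) ((2 ^ L : ℕ) : ℤ) z ρ' = 0) →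
      (∀ w : HeightOneSpectrum (𝓞 K), z ∈ selmerLocalKer (W.baseChange K) (w.adicCompletion K) ((2 ^ L : ℕ) : ℤ)) → z = 0)
    (Dt : ModularParametrizationData W (W.conductorNorm ℤ)) (β : ℤ) (ι : K →+* ℂ) (d₁ : KolyvaginHeegnerData Dt β ι 1) (M₀ : ℕ)
    (hndiv : ¬ ∃ Q : (W.baseChange (ringClassField K ι 1)).toAffine.Point, ((2 ^ (M₀ + 1) : ℕ) : ℤ) • Q = d₁.derivedPoint)
    (hw1 : W.rootNumber = 1)
    (hPair : ∀ (n : ℕ) (c : K ≃ₐ[ℚ] K), c ≠ 1 →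
      ∀ (x y : galH1Torsion (W.baseChange K) ((2 ^ (n + 1) : ℕ) : ℤ)) (ex ey : ℕ), 1 ≤ ex → 1 ≤ ey →
      addOrderOf x = 2 ^ ex → addOrderOf y = 2 ^ ey →
      ∀ (sx sy : ℤ), (sx = 1 ∨ sx = -1) → (sy = 1 ∨ sy = -1) →
      conjAct W c ((2 ^ (n + 1) : ℕ) : ℤ) x = sx • x → conjAct W c ((2 ^ (n + 1) : ℕ) : ℤ) y = sy • y →
      (∀ a b : ℤ, (∀ ρ ∈ torsionFixing (W.baseChange K) ((2 ^ (n + 1) : ℕ) : ℤ),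
          h1Eval (W.baseChange K) ((2 ^ (n + 1) : ℕ) : ℤ) (a • x + b • y) ρ = 0) → a • x + b • y = 0) →
      ∃ ℓ : ℕ, Zhang2014.IsKolyvaginPrime (W.conductorNorm ℤ) W K 2 ℓ ∧ n + 1 ≤ Zhang2014.kolyvaginIndex W 2 ℓ ∧
        (∃ (v : HeightOneSpectrum (𝓞 ℚ)) (𝔓 : Ideal (absIntegers (𝓞 ℚ) ℚ)) (h c₀ : absoluteGaloisGroup ℚ),
          (ℓ : 𝓞 ℚ) ∈ v.asIdeal ∧ 𝔓 ∈ v.primesAbove ∧ IsArithFrobAt (𝓞 ℚ) h 𝔓 ∧ IsComplexConjugation (Rat.castHom ℝ) c₀ ∧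
          (∀ X : geomTorsion W ((2 ^ (n + 1) : ℕ) : ℤ), h • h • X = X) ∧
          (∃ u : geomTorsion W ((2 : ℕ) : ℤ), h • u ≠ u) ∧
          ∀ (e : K →ₐ[ℚ] AlgebraicClosure ℚ) (z : K), h • e z = c₀ • e z) ∧
        ∀ w : HeightOneSpectrum (𝓞 K), (ℓ : 𝓞 K) ∈ w.asIdeal →
          (∀ j : ℕ, ((2 ^ j : ℕ) : ℤ) • x ∈ (W.baseChange K).torsionLocalKer (w.adicCompletion K) ((2 ^ (n + 1) : ℕ) : ℤ) ↔ ex ≤ j) ∧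
          (∀ j : ℕ, ((2 ^ j : ℕ) : ℤ) • y ∈ (W.baseChange K).torsionLocalKer (w.adicCompletion K) ((2 ^ (n + 1) : ℕ) : ℤ) ↔ ey ≤ j))
    (M : ℕ) (s₀ : galH1Torsion W ((2 ^ M : ℕ) : ℤ)) (hs₀ : s₀ ∈ selmerGroup W ((2 ^ M : ℕ) : ℤ))
    (hne : ((2 ^ (M₀ - 1) : ℕ) : ℤ) • s₀ ≠ 0) :
    ∃ (ℓ : ℕ) (d : KolyvaginHeegnerData Dt β ι (1 * ℓ)),
      Zhang2014.IsKolyvaginPrime (W.conductorNorm ℤ) W K 2 ℓ ∧ 2 ≤ Zhang2014.kolyvaginIndex W 2 ℓ ∧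
      (∃ (v : HeightOneSpectrum (𝓞 ℚ)) (𝔓 : Ideal (absIntegers (𝓞 ℚ) ℚ)) (h c₀ : absoluteGaloisGroup ℚ),
          (ℓ : 𝓞 ℚ) ∈ v.asIdeal ∧ 𝔓 ∈ v.primesAbove ∧ IsArithFrobAt (𝓞 ℚ) h 𝔓 ∧ IsComplexConjugation (Rat.castHom ℝ) c₀ ∧
          (∀ X : geomTorsion W ((2 : ℕ) : ℤ), h • h • X = X) ∧
          (∃ u : geomTorsion W ((2 : ℕ) : ℤ), h • u ≠ u) ∧
          ∀ (e : K →ₐ[ℚ] AlgebraicClosure ℚ) (z : K), h • e z = c₀ • e z) ∧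
      (∀ s ∈ d₁.S, ∃ s' ∈ d.S, ∀ (x : ringClassField K ι 1) (x' : ringClassField K ι (1 * ℓ)),
          (x : ℂ) = x' → ((s' x' : ringClassField K ι (1 * ℓ)) : ℂ) = (s x : ℂ)) ∧
      (∀ (x : ringClassField K ι 1) (x' : ringClassField K ι (1 * ℓ)), (x : ℂ) = x' → d.emb x' = d₁.emb x) ∧
      ¬ ∃ Q : (W.baseChange (ringClassField K ι (1 * ℓ))).toAffine.Point, (2 : ℤ) • Q = d.derivedPoint := by
  haveI : Fact (Nat.Prime 2) := ⟨Nat.prime_two⟩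
  have hs2 : W.HasSurjectiveModNGaloisRep 2 := by simpa using hρ 1 one_pos
  -- move `s₀` up to level `2^(M + M₀ + 1) ≥ 2^(M₀ + 1)`
  have hdvd : ((2 ^ M : ℕ) : ℤ) ∣ ((2 ^ (M + M₀ + 1) : ℕ) : ℤ) := natCast_pow_dvd_natCast_pow (p := 2) (by omega)
  have hinj : Function.Injective (torsionH1OfDvd W hdvd) :=
    VisiblePairAtTwo.torsionH1OfDvd_pow_injective W (p := 2) (VisiblePairAtTwo.torsionBy_two_eq_bot_of_surj W hs2) hdvd
  have hs₀' : torsionH1OfDvd W hdvd s₀ ∈ selmerGroup W ((2 ^ (M + M₀ + 1) : ℕ) : ℤ) := torsionH1OfDvd_mem_selmerGroup W hdvd hs₀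
  have hne' : ((2 ^ (M₀ - 1) : ℕ) : ℤ) • torsionH1OfDvd W hdvd s₀ ≠ 0 := fun h ↦
    hne (hinj (by rw [map_zsmul, map_zero, h]))
  obtain ⟨ℓ, d, hkol, hidx, ⟨v, 𝔓, h, c₀, hℓv, h𝔓, hh, hc₀, hhsq, hhu, hhK⟩, hS, hemb, hwit⟩ :=
    exists_transpositionDeep_primitive_of_two_pow_pred_smul_ne_zero_of_nonPhantom_of_regularPairSupply hQ2 W hcm hT K hIQ hodd h3 hHe hρ
      hNPh Dt β ι d₁ M₀ hndiv hw1 hPair (M + M₀ + 1) (by omega) _ hs₀' hne'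
  exact ⟨ℓ, d, hkol, le_trans (by omega) hidx,
    ⟨v, 𝔓, h, c₀, hℓv, h𝔓, hh, hc₀, smul_smul_eq_self_of_dvd W (by exact_mod_cast dvd_pow_self 2 (by omega : M + M₀ + 1 + 2 ≠ 0)) hhsq,
      hhu, hhK⟩, hS, hemb, hwit⟩

/-- **B2Q♭ with the regular signed pair-Čebotarev supply DISCHARGED** (`regularPairSupply_of_heegner`): on the whole habitat modulo Q2 and
(NPh_K) only — non-CM, odd Tamagawa product, `ρ_{E,2^n}` onto; `K` imaginary quadratic, `d_K` odd `≠ −3`, Heegner; `d₁` with `2^{M₀+1} ∤ P(1)`;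
`w(E) = +1` — **a class `s₀ ∈ Sel_(2^M)(E/ℚ)` with `2^{M₀−1} • s₀ ≠ 0` yields a transposition-deep Kolyvagin prime `ℓ` (index `≥ 2`,
Frobenius involution of `E[2]` moving a point, complex conjugation on `K`) and a datum of conductor `1·ℓ`, compatible with `d₁`, with
`P(1·ℓ) ∉ 2E(K[1·ℓ])`.**  BSD is NOT proved by this. [cite: McCallumLMS1991, §5 Lemma 5.3, Thm. 5.4] [cite: Kolyvagin1989Izv, Thm. B₂] -/
theorem exists_transpositionDeep_primitive_of_two_pow_pred_smul_ne_zero_of_nonPhantom (hQ2 : KolyvaginRelationAtTwo)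
    (W : WeierstrassCurve ℚ) [W.IsElliptic] [W.IsGloballyMinimal] [NeZero (W.conductorNorm ℤ)] (hcm : ¬ W.HasCM)
    (hT : Odd W.tamagawaProduct)
    (K : Type) [Field K] [NumberField K] (hIQ : IsImaginaryQuadratic K) (hodd : Odd (NumberField.discr K))
    (h3 : NumberField.discr K ≠ -3) (hHe : SatisfiesHeegnerHypothesis (W.conductorNorm ℤ) K)
    (hρ : ∀ n : ℕ, 0 < n → W.HasSurjectiveModNGaloisRep ((2 : ℤ) ^ n))
    (hNPh : ∀ (L : ℕ), 1 ≤ L → ∀ z : galH1Torsion (W.baseChange K) ((2 ^ L : ℕ) : ℤ),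
      (∀ ρ' ∈ torsionFixing (W.baseChange K) ((2 ^ L : ℕ) : ℤ), h1Eval (W.baseChange K) ((2 ^ L : ℕ) : ℤ) z ρ' = 0) →
      (∀ w : HeightOneSpectrum (𝓞 K), z ∈ selmerLocalKer (W.baseChange K) (w.adicCompletion K) ((2 ^ L : ℕ) : ℤ)) → z = 0)
    (Dt : ModularParametrizationData W (W.conductorNorm ℤ)) (β : ℤ) (ι : K →+* ℂ) (d₁ : KolyvaginHeegnerData Dt β ι 1) (M₀ : ℕ)
    (hndiv : ¬ ∃ Q : (W.baseChange (ringClassField K ι 1)).toAffine.Point, ((2 ^ (M₀ + 1) : ℕ) : ℤ) • Q = d₁.derivedPoint)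
    (hw1 : W.rootNumber = 1)
    (M : ℕ) (s₀ : galH1Torsion W ((2 ^ M : ℕ) : ℤ)) (hs₀ : s₀ ∈ selmerGroup W ((2 ^ M : ℕ) : ℤ))
    (hne : ((2 ^ (M₀ - 1) : ℕ) : ℤ) • s₀ ≠ 0) :
    ∃ (ℓ : ℕ) (d : KolyvaginHeegnerData Dt β ι (1 * ℓ)),
      Zhang2014.IsKolyvaginPrime (W.conductorNorm ℤ) W K 2 ℓ ∧ 2 ≤ Zhang2014.kolyvaginIndex W 2 ℓ ∧
      (∃ (v : HeightOneSpectrum (𝓞 ℚ)) (𝔓 : Ideal (absIntegers (𝓞 ℚ) ℚ)) (h c₀ : absoluteGaloisGroup ℚ),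
          (ℓ : 𝓞 ℚ) ∈ v.asIdeal ∧ 𝔓 ∈ v.primesAbove ∧ IsArithFrobAt (𝓞 ℚ) h 𝔓 ∧ IsComplexConjugation (Rat.castHom ℝ) c₀ ∧
          (∀ X : geomTorsion W ((2 : ℕ) : ℤ), h • h • X = X) ∧
          (∃ u : geomTorsion W ((2 : ℕ) : ℤ), h • u ≠ u) ∧
          ∀ (e : K →ₐ[ℚ] AlgebraicClosure ℚ) (z : K), h • e z = c₀ • e z) ∧
      (∀ s ∈ d₁.S, ∃ s' ∈ d.S, ∀ (x : ringClassField K ι 1) (x' : ringClassField K ι (1 * ℓ)),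
          (x : ℂ) = x' → ((s' x' : ringClassField K ι (1 * ℓ)) : ℂ) = (s x : ℂ)) ∧
      (∀ (x : ringClassField K ι 1) (x' : ringClassField K ι (1 * ℓ)), (x : ℂ) = x' → d.emb x' = d₁.emb x) ∧
      ¬ ∃ Q : (W.baseChange (ringClassField K ι (1 * ℓ))).toAffine.Point, (2 : ℤ) • Q = d.derivedPoint :=
  exists_transpositionDeep_primitive_of_two_pow_pred_smul_ne_zero_of_nonPhantom_of_regularPairSupply' hQ2 W hcm hT K hIQ hodd h3 hHe hρ hNPh
    Dt β ι d₁ M₀ hndiv hw1 (regularPairSupply_of_heegner W K hIQ hodd hHe hρ) M s₀ hs₀ hne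

/-- **B2Q♭ ON THE MULTIPLICATIVE CUT, everything discharged but Q2** (U_T / U⁺_T's frame: an odd multiplicative prime `v` and the two
Theorem-B₂ non-square side conditions feed (NPh_K) by `NonPhantomPow.nonPhantomAtTwo_of_hasMultiplicativeReductionAt`): **a class
`s₀ ∈ Sel_(2^M)(E/ℚ)` with `2^{M₀−1} • s₀ ≠ 0` yields a transposition-deep prime-level K₄-witness** (as in `…_of_nonPhantom`).  ANY sign of `Δ(E)`.
BSD is NOT proved by this. [cite: McCallumLMS1991, §5 Lemma 5.3, Thm. 5.4] [cite: Kolyvagin1989Izv, Thm. B₂, §3] [cite: LawsonWuthrich2016, §7.1] -/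
theorem exists_transpositionDeep_primitive_of_two_pow_pred_smul_ne_zero (hQ2 : KolyvaginRelationAtTwo)
    (W : WeierstrassCurve ℚ) [W.IsElliptic] [W.IsGloballyMinimal] [NeZero (W.conductorNorm ℤ)] (hcm : ¬ W.HasCM)
    (hT : Odd W.tamagawaProduct) (v : HeightOneSpectrum (𝓞 ℚ)) (h2v : ((2 : ℕ) : 𝓞 ℚ) ∉ v.asIdeal)
    (hNv : ((W.conductorNorm ℤ : ℕ) : 𝓞 ℚ) ∈ v.asIdeal) (hmult : W.HasMultiplicativeReductionAt v)
    (K : Type) [Field K] [NumberField K] (hIQ : IsImaginaryQuadratic K) (hodd : Odd (NumberField.discr K))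
    (h3 : NumberField.discr K ≠ -3) (hHe : SatisfiesHeegnerHypothesis (W.conductorNorm ℤ) K)
    (hsq1 : ¬ IsSquare ((NumberField.discr K : ℚ) * -|W.Δ|)) (hsq2 : ¬ IsSquare ((NumberField.discr K : ℚ) * (-(2 * |W.Δ|))))
    (hρ : ∀ n : ℕ, 0 < n → W.HasSurjectiveModNGaloisRep ((2 : ℤ) ^ n))
    (Dt : ModularParametrizationData W (W.conductorNorm ℤ)) (β : ℤ) (ι : K →+* ℂ) (d₁ : KolyvaginHeegnerData Dt β ι 1) (M₀ : ℕ)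
    (hndiv : ¬ ∃ Q : (W.baseChange (ringClassField K ι 1)).toAffine.Point, ((2 ^ (M₀ + 1) : ℕ) : ℤ) • Q = d₁.derivedPoint)
    (hw1 : W.rootNumber = 1)
    (M : ℕ) (s₀ : galH1Torsion W ((2 ^ M : ℕ) : ℤ)) (hs₀ : s₀ ∈ selmerGroup W ((2 ^ M : ℕ) : ℤ))
    (hne : ((2 ^ (M₀ - 1) : ℕ) : ℤ) • s₀ ≠ 0) :
    ∃ (ℓ : ℕ) (d : KolyvaginHeegnerData Dt β ι (1 * ℓ)),
      Zhang2014.IsKolyvaginPrime (W.conductorNorm ℤ) W K 2 ℓ ∧ 2 ≤ Zhang2014.kolyvaginIndex W 2 ℓ ∧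
      (∃ (v : HeightOneSpectrum (𝓞 ℚ)) (𝔓 : Ideal (absIntegers (𝓞 ℚ) ℚ)) (h c₀ : absoluteGaloisGroup ℚ),
          (ℓ : 𝓞 ℚ) ∈ v.asIdeal ∧ 𝔓 ∈ v.primesAbove ∧ IsArithFrobAt (𝓞 ℚ) h 𝔓 ∧ IsComplexConjugation (Rat.castHom ℝ) c₀ ∧
          (∀ X : geomTorsion W ((2 : ℕ) : ℤ), h • h • X = X) ∧
          (∃ u : geomTorsion W ((2 : ℕ) : ℤ), h • u ≠ u) ∧
          ∀ (e : K →ₐ[ℚ] AlgebraicClosure ℚ) (z : K), h • e z = c₀ • e z) ∧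
      (∀ s ∈ d₁.S, ∃ s' ∈ d.S, ∀ (x : ringClassField K ι 1) (x' : ringClassField K ι (1 * ℓ)),
          (x : ℂ) = x' → ((s' x' : ringClassField K ι (1 * ℓ)) : ℂ) = (s x : ℂ)) ∧
      (∀ (x : ringClassField K ι 1) (x' : ringClassField K ι (1 * ℓ)), (x : ℂ) = x' → d.emb x' = d₁.emb x) ∧
      ¬ ∃ Q : (W.baseChange (ringClassField K ι (1 * ℓ))).toAffine.Point, (2 : ℤ) • Q = d.derivedPoint := by
  have hN : (W.conductorNorm ℤ) ≠ 0 := NeZero.ne _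
  have hNPh : ∀ (L : ℕ), 1 ≤ L → ∀ z : galH1Torsion (W.baseChange K) ((2 ^ L : ℕ) : ℤ),
      (∀ ρ' ∈ torsionFixing (W.baseChange K) ((2 ^ L : ℕ) : ℤ), h1Eval (W.baseChange K) ((2 ^ L : ℕ) : ℤ) z ρ' = 0) →
      (∀ w : HeightOneSpectrum (𝓞 K), z ∈ selmerLocalKer (W.baseChange K) (w.adicCompletion K) ((2 ^ L : ℕ) : ℤ)) → z = 0 :=
    fun L hL z hz hzS ↦ NonPhantomPow.nonPhantomAtTwo_of_hasMultiplicativeReductionAt (W := W) (K := K) hT hρ hIQ hodd hsq1 hsq2 hN hHe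
      h2v hNv hmult L hL z hz (fun w _ ↦ hzS w)
  exact exists_transpositionDeep_primitive_of_two_pow_pred_smul_ne_zero_of_nonPhantom hQ2 W hcm hT K hIQ hodd h3 hHe hρ hNPh Dt β ι d₁ M₀
    hndiv hw1 M s₀ hs₀ hne

/-- **THE K4Pos / K4Neg SHAPE.**  On the same frame (multiplicative cut, Q2 by name), from ONE class `s₀ ∈ Sel_(2^M)(E/ℚ)` with
`2^{M₀−1} • s₀ ≠ 0`: the CONCLUSION of the route items `K4Pos` (stmt-31469) and `K4Neg` (31526) VERBATIM in shape — `∃ n` square-free (here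
`n = 1·ℓ`, ONE prime), `∃ d : KolyvaginHeegnerData Dt β ι n`, every `ℓ ∣ n` a Zhang–Kolyvagin prime at `2` of index `≥ 2` carrying an
arithmetic Frobenius that MOVES a point of `E[2]` (the transposition-deep clause of K4Pos; on `Δ < 0` such a Frobenius, which also acts on `K`
as a complex conjugation, is K4Neg's `FrobEqFrobInfty`-type prime up to the tree's bookkeeping), and `P(n) ∉ 2E(K[n])`.  So K₄⁺/K₄ are
implied, modulo Q2 on the cut, by «`Sel_(2^∞)(E/ℚ)` has a class of order `2^{M₀}`» = «Kolyvagin's B₂ over `ℚ` is SHARP for `E`».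
BSD is NOT proved by this; K4Pos is NOT proved by this. [cite: McCallumLMS1991, §5 Thm. 5.4] [cite: Kolyvagin1989Izv, Thm. B₂] -/
theorem kFourPos_shape_of_two_pow_pred_smul_ne_zero (hQ2 : KolyvaginRelationAtTwo)
    (W : WeierstrassCurve ℚ) [W.IsElliptic] [W.IsGloballyMinimal] [NeZero (W.conductorNorm ℤ)] (hcm : ¬ W.HasCM)
    (hT : Odd W.tamagawaProduct) (v : HeightOneSpectrum (𝓞 ℚ)) (h2v : ((2 : ℕ) : 𝓞 ℚ) ∉ v.asIdeal)
    (hNv : ((W.conductorNorm ℤ : ℕ) : 𝓞 ℚ) ∈ v.asIdeal) (hmult : W.HasMultiplicativeReductionAt v)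
    (K : Type) [Field K] [NumberField K] (hIQ : IsImaginaryQuadratic K) (hodd : Odd (NumberField.discr K))
    (h3 : NumberField.discr K ≠ -3) (hHe : SatisfiesHeegnerHypothesis (W.conductorNorm ℤ) K)
    (hsq1 : ¬ IsSquare ((NumberField.discr K : ℚ) * -|W.Δ|)) (hsq2 : ¬ IsSquare ((NumberField.discr K : ℚ) * (-(2 * |W.Δ|))))
    (hρ : ∀ n : ℕ, 0 < n → W.HasSurjectiveModNGaloisRep ((2 : ℤ) ^ n))
    (Dt : ModularParametrizationData W (W.conductorNorm ℤ)) (β : ℤ) (ι : K →+* ℂ) (d₁ : KolyvaginHeegnerData Dt β ι 1) (M₀ : ℕ)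
    (hndiv : ¬ ∃ Q : (W.baseChange (ringClassField K ι 1)).toAffine.Point, ((2 ^ (M₀ + 1) : ℕ) : ℤ) • Q = d₁.derivedPoint)
    (hw1 : W.rootNumber = 1)
    (hsharp : ∃ (M : ℕ) (s₀ : galH1Torsion W ((2 ^ M : ℕ) : ℤ)), s₀ ∈ selmerGroup W ((2 ^ M : ℕ) : ℤ) ∧ ((2 ^ (M₀ - 1) : ℕ) : ℤ) • s₀ ≠ 0) :
    ∃ (n : ℕ) (d : KolyvaginHeegnerData Dt β ι n), Squarefree n ∧
      (∀ ℓ ∈ n.primeFactors, Zhang2014.IsKolyvaginPrime (W.conductorNorm ℤ) W K 2 ℓ ∧ 2 ≤ Zhang2014.kolyvaginIndex W 2 ℓ ∧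
        ∃ (v : HeightOneSpectrum (𝓞 ℚ)) (𝔓 : Ideal (absIntegers (𝓞 ℚ) ℚ)) (h : absoluteGaloisGroup ℚ),
          ((ℓ : ℕ) : 𝓞 ℚ) ∈ v.asIdeal ∧ 𝔓 ∈ v.primesAbove ∧ IsArithFrobAt (𝓞 ℚ) h 𝔓 ∧ ∃ u : W.geomTorsion ((2 : ℕ) : ℤ), h • u ≠ u) ∧
      ¬ ∃ Q : (W.baseChange (ringClassField K ι n)).toAffine.Point, (2 : ℤ) • Q = d.derivedPoint := by
  obtain ⟨M, s₀, hs₀, hne⟩ := hsharp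
  obtain ⟨ℓ, d, hkol, hidx, ⟨v', 𝔓, h, c₀, hℓv, h𝔓, hh, -, -, hhu, -⟩, -, -, hwit⟩ :=
    exists_transpositionDeep_primitive_of_two_pow_pred_smul_ne_zero hQ2 W hcm hT v h2v hNv hmult K hIQ hodd h3 hHe hsq1 hsq2 hρ Dt β ι d₁ M₀
      hndiv hw1 M s₀ hs₀ hne
  have hℓp : ℓ.Prime := hkol.1
  refine ⟨1 * ℓ, d, by rw [one_mul]; exact hℓp.squarefree, fun q hq ↦ ?_, hwit⟩
  rw [one_mul, hℓp.primeFactors, Finset.mem_singleton] at hq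
  subst hq
  exact ⟨hkol, hidx, v', 𝔓, h, hℓv, h𝔓, hh, hhu⟩

/-- **DEPTH ONE (`M₀ = 1`): K₄⁺ / K₄ HOLD AT A SINGLE PRIME, modulo Q2, on the multiplicative cut.**  If `4 ∤ P(1)` in `E(K[1])` (depth
`M₀ ≤ 1`) and `Sel₂(E/ℚ) ≠ 0` (e.g. the K₄/K₄⁺ cells, `#Sel₂(E) = 4`), then ANY non-zero `s₀ ∈ Sel₂(E/ℚ)` has `2^{M₀−1} • s₀ = s₀ ≠ 0`, so B2Q♭
PRODUCES a transposition-deep Kolyvagin prime `ℓ` and a datum of conductor `ℓ` with `P(ℓ) ∉ 2E(K[ℓ])`: **the conclusion of K4Pos (VERBATIM in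
shape) resp. K4Neg (up to the typing of its `FrobEqFrobInfty` prime clause) on the DEPTH-ONE sub-cell is a THEOREM modulo Q2 (= modulo the print
fact 23091)** — no detection hypothesis, no structure theorem; the `p = 2` first block «`Sel ≠ 0 ∧ M₀ = 1 ⟹ 𝓜₁ = 0`» read on the `ℚ`-side.
(LEAD g23's memo `DEPTH-ONE-FIRST-BLOCK-g23.md` reaches the K₄ case `K`-side modulo {23091, DET}; this is the `ℚ`-side twin, DET-free.)
BSD is NOT proved by this; K4Pos / K4Neg are NOT closed by this (depth one is a sub-cell). [cite: McCallumLMS1991, §5 Lemma 5.3, Thm. 5.4]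
[cite: Kolyvagin1989Izv, Thm. B₂, §3] -/
theorem kFourPos_shape_of_depth_le_one (hQ2 : KolyvaginRelationAtTwo)
    (W : WeierstrassCurve ℚ) [W.IsElliptic] [W.IsGloballyMinimal] [NeZero (W.conductorNorm ℤ)] (hcm : ¬ W.HasCM)
    (hT : Odd W.tamagawaProduct) (v : HeightOneSpectrum (𝓞 ℚ)) (h2v : ((2 : ℕ) : 𝓞 ℚ) ∉ v.asIdeal)
    (hNv : ((W.conductorNorm ℤ : ℕ) : 𝓞 ℚ) ∈ v.asIdeal) (hmult : W.HasMultiplicativeReductionAt v)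
    (K : Type) [Field K] [NumberField K] (hIQ : IsImaginaryQuadratic K) (hodd : Odd (NumberField.discr K))
    (h3 : NumberField.discr K ≠ -3) (hHe : SatisfiesHeegnerHypothesis (W.conductorNorm ℤ) K)
    (hsq1 : ¬ IsSquare ((NumberField.discr K : ℚ) * -|W.Δ|)) (hsq2 : ¬ IsSquare ((NumberField.discr K : ℚ) * (-(2 * |W.Δ|))))
    (hρ : ∀ n : ℕ, 0 < n → W.HasSurjectiveModNGaloisRep ((2 : ℤ) ^ n))
    (Dt : ModularParametrizationData W (W.conductorNorm ℤ)) (β : ℤ) (ι : K →+* ℂ) (d₁ : KolyvaginHeegnerData Dt β ι 1)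
    (hndiv : ¬ ∃ Q : (W.baseChange (ringClassField K ι 1)).toAffine.Point, ((2 ^ (1 + 1) : ℕ) : ℤ) • Q = d₁.derivedPoint)
    (hw1 : W.rootNumber = 1) (hSel : 1 < Nat.card (W.selmerGroup 2)) :
    ∃ (n : ℕ) (d : KolyvaginHeegnerData Dt β ι n), Squarefree n ∧
      (∀ ℓ ∈ n.primeFactors, Zhang2014.IsKolyvaginPrime (W.conductorNorm ℤ) W K 2 ℓ ∧ 2 ≤ Zhang2014.kolyvaginIndex W 2 ℓ ∧
        ∃ (v : HeightOneSpectrum (𝓞 ℚ)) (𝔓 : Ideal (absIntegers (𝓞 ℚ) ℚ)) (h : absoluteGaloisGroup ℚ),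
          ((ℓ : ℕ) : 𝓞 ℚ) ∈ v.asIdeal ∧ 𝔓 ∈ v.primesAbove ∧ IsArithFrobAt (𝓞 ℚ) h 𝔓 ∧ ∃ u : W.geomTorsion ((2 : ℕ) : ℤ), h • u ≠ u) ∧
      ¬ ∃ Q : (W.baseChange (ringClassField K ι n)).toAffine.Point, (2 : ℤ) • Q = d.derivedPoint := by
  -- a non-zero `2`-Selmer class over `ℚ`, at level `2 = 2^1`
  have hSel' : 1 < Nat.card (selmerGroup W ((2 ^ 1 : ℕ) : ℤ)) := by rw [pow_one, Nat.cast_ofNat]; exact hSel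
  have hbot : selmerGroup W ((2 ^ 1 : ℕ) : ℤ) ≠ ⊥ := fun h ↦ by rw [h, AddSubgroup.card_bot] at hSel'; exact lt_irrefl _ hSel'
  obtain ⟨⟨s₀, hs₀⟩, hne⟩ := AddSubgroup.ne_bot_iff_exists_ne_zero.mp hbot
  have hne' : ((2 ^ (1 - 1) : ℕ) : ℤ) • s₀ ≠ 0 := by
    rw [Nat.sub_self, pow_zero, Nat.cast_one, one_zsmul]
    rintro rfl
    exact hne (Subtype.ext rfl)
  exact kFourPos_shape_of_two_pow_pred_smul_ne_zero hQ2 W hcm hT v h2v hNv hmult K hIQ hodd h3 hHe hsq1 hsq2 hρ Dt β ι d₁ 1 hndiv hw1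
    ⟨1, s₀, hs₀, hne'⟩

/-- **K4Pos ON ITS DEPTH-ONE SUB-CELL, modulo Q2 and one odd multiplicative prime** — the item's binders VERBATIM (habitat, `Δ > 0`, the real-narrow
`#Sel₂(E) = 4` cell, prime Heegner frame, odd-Manin datum, `2^{M₀} ∥ P(1)`, shallow Sel₂-minimal rank-`1` twin) PLUS `M₀ = 1` and a multiplicative
prime `v ∤ 2` of `E`: the conclusion of K4Pos.  (`w(E) = +1` from `r_an(E) = 0` by the functional equation of the newform of `Dt`; most binders are
idle and displayed for by-name use.)  BSD is NOT proved by this; K4Pos (all depths) is NOT closed by this. [cite: McCallumLMS1991, §5 Thm. 5.4]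
[cite: Kolyvagin1989Izv, Thm. B₂] -/
theorem kFourPos_conclusion_of_depth_one_of_hasMultiplicativeReductionAt (hQ2 : KolyvaginRelationAtTwo)
    (W : WeierstrassCurve ℚ) [W.IsElliptic] [W.IsGloballyMinimal] [NeZero (W.conductorNorm ℤ)] (hcm : ¬ W.HasCM) (hr0 : W.analyticRank = 0)
    (hρ : ∀ n : ℕ, 0 < n → W.HasSurjectiveModNGaloisRep ((2 : ℤ) ^ n)) (hT : Odd W.tamagawaProduct) (_hΔ : 0 < W.Δ)
    (hcell : Nat.card (W.selmerGroup 2) = 4 ∧ ∃ c ∈ (W.kummerSelmerStructure ((2 : ℕ) : ℤ)).selmerGroup,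
      Literature.NumberTheory.GaloisRepresentations.galoisCohomology.localization (W.torsionGaloisModule ((2 : ℕ) : ℤ))
        (Sum.inl Rat.infinitePlace) 1 c ≠ 0)
    (v : HeightOneSpectrum (𝓞 ℚ)) (h2v : ((2 : ℕ) : 𝓞 ℚ) ∉ v.asIdeal) (hNv : ((W.conductorNorm ℤ : ℕ) : 𝓞 ℚ) ∈ v.asIdeal)
    (hmult : W.HasMultiplicativeReductionAt v)
    (K : Type) [Field K] [NumberField K] (hIQ : IsImaginaryQuadratic K) (hodd : Odd (NumberField.discr K))
    (h3 : NumberField.discr K ≠ -3) (hHe : SatisfiesHeegnerHypothesis (W.conductorNorm ℤ) K)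
    (hsq1 : ¬ IsSquare ((NumberField.discr K : ℚ) * -|W.Δ|)) (hsq2 : ¬ IsSquare ((NumberField.discr K : ℚ) * (-(2 * |W.Δ|))))
    (ℓ₀ : ℕ) (_hℓ₀ : ℓ₀.Prime) (_hdK : NumberField.discr K = -(ℓ₀ : ℤ))
    (_h2K : ((Ideal.span {(2 : ℤ)}).primesOver (NumberField.RingOfIntegers K)).ncard = 2)
    (Dt : ModularParametrizationData W (W.conductorNorm ℤ))
    (_hopt : ∀ z ∈ Dt.L.lattice, ∃ w ∈ periodLattice Dt.f, z = (Dt.c : ℂ) * w) (_hc : Odd Dt.c)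
    (β : ℤ) (ι : K →+* ℂ) (d₁ : KolyvaginHeegnerData Dt β ι 1) (_hy : ¬ IsOfFinAddOrder d₁.derivedPoint) (M₀ : ℕ)
    (_hdiv : ∃ Q : (W.baseChange (ringClassField K ι 1)).toAffine.Point, ((2 ^ M₀ : ℕ) : ℤ) • Q = d₁.derivedPoint)
    (hndiv : ¬ ∃ Q : (W.baseChange (ringClassField K ι 1)).toAffine.Point, ((2 ^ (M₀ + 1) : ℕ) : ℤ) • Q = d₁.derivedPoint)
    (hM₀ : M₀ = 1)
    (Wd : WeierstrassCurve ℚ) [Wd.IsElliptic] [Wd.IsGloballyMinimal]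
    (_hWd : ∃ C : VariableChange ℚ, C • W.quadraticTwist (NumberField.discr K : ℚ) = Wd) (_hrd : Wd.analyticRank = 1)
    (_hSelWd : Nat.card (Wd.selmerGroup 2) = 2) (_hTam : padicValNat 2 Wd.tamagawaProduct = 0) :
    ∃ (n : ℕ) (d : KolyvaginHeegnerData Dt β ι n), Squarefree n ∧
      (∀ ℓ ∈ n.primeFactors, Zhang2014.IsKolyvaginPrime (W.conductorNorm ℤ) W K 2 ℓ ∧ 2 ≤ Zhang2014.kolyvaginIndex W 2 ℓ ∧
        ∃ (v : HeightOneSpectrum (𝓞 ℚ)) (𝔓 : Ideal (absIntegers (𝓞 ℚ) ℚ)) (h : absoluteGaloisGroup ℚ),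
          ((ℓ : ℕ) : 𝓞 ℚ) ∈ v.asIdeal ∧ 𝔓 ∈ v.primesAbove ∧ IsArithFrobAt (𝓞 ℚ) h 𝔓 ∧ ∃ u : W.geomTorsion ((2 : ℕ) : ℤ), h • u ≠ u) ∧
      ¬ ∃ Q : (W.baseChange (ringClassField K ι n)).toAffine.Point, (2 : ℤ) • Q = d.derivedPoint := by
  subst hM₀
  have hw : W.rootNumber = 1 :=
    (Literature.Barriers.BirchSwinnertonDyer.even_analyticRank_iff_of_isNewformOf_conductorLevel Dt.isNewformOf).mp
      (by rw [hr0]; exact Even.zero)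
  exact kFourPos_shape_of_depth_le_one hQ2 W hcm hT v h2v hNv hmult K hIQ hodd h3 hHe hsq1 hsq2 hρ Dt β ι d₁ hndiv hw (by rw [hcell.1]; norm_num)

/-- **B2Q♭, CONTRAPOSITIVE FORM: `2^{M₀−1} · Sel_(2^M)(E/ℚ) = 0` when NO transposition-deep prime-level witness exists.**  On the
multiplicative cut modulo Q2: if for every Zhang–Kolyvagin prime `ℓ` at `2` of index `≥ 2` admitting an arithmetic Frobenius that is an
involution of `E[2]` moving a point and acting on `K` as a complex conjugation, EVERY datum of conductor `1·ℓ` has a `2`-divisible derived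
point, then `2^{M₀−1} • s₀ = 0` for every `s₀ ∈ Sel_(2^M)(E/ℚ)`, every `M` — one bit below Kolyvagin's B₂ (`2^{M₀}`), the `p = 2`,
sign-free, `ℚ`-side shadow of McCallum's `N₁ = M₀ − M₁` at `M₁ ≥ 1`.  BSD is NOT proved by this. [cite: McCallumLMS1991, §5 Thm. 5.4]
[cite: Kolyvagin1989Izv, Thm. B₂, §3] -/
theorem two_pow_pred_smul_selmer_rat_eq_zero_of_forall_two_dvd (hQ2 : KolyvaginRelationAtTwo)
    (W : WeierstrassCurve ℚ) [W.IsElliptic] [W.IsGloballyMinimal] [NeZero (W.conductorNorm ℤ)] (hcm : ¬ W.HasCM)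
    (hT : Odd W.tamagawaProduct) (v : HeightOneSpectrum (𝓞 ℚ)) (h2v : ((2 : ℕ) : 𝓞 ℚ) ∉ v.asIdeal)
    (hNv : ((W.conductorNorm ℤ : ℕ) : 𝓞 ℚ) ∈ v.asIdeal) (hmult : W.HasMultiplicativeReductionAt v)
    (K : Type) [Field K] [NumberField K] (hIQ : IsImaginaryQuadratic K) (hodd : Odd (NumberField.discr K))
    (h3 : NumberField.discr K ≠ -3) (hHe : SatisfiesHeegnerHypothesis (W.conductorNorm ℤ) K)
    (hsq1 : ¬ IsSquare ((NumberField.discr K : ℚ) * -|W.Δ|)) (hsq2 : ¬ IsSquare ((NumberField.discr K : ℚ) * (-(2 * |W.Δ|))))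
    (hρ : ∀ n : ℕ, 0 < n → W.HasSurjectiveModNGaloisRep ((2 : ℤ) ^ n))
    (Dt : ModularParametrizationData W (W.conductorNorm ℤ)) (β : ℤ) (ι : K →+* ℂ) (d₁ : KolyvaginHeegnerData Dt β ι 1) (M₀ : ℕ)
    (hndiv : ¬ ∃ Q : (W.baseChange (ringClassField K ι 1)).toAffine.Point, ((2 ^ (M₀ + 1) : ℕ) : ℤ) • Q = d₁.derivedPoint)
    (hw1 : W.rootNumber = 1)
    (hno : ∀ ℓ : ℕ, Zhang2014.IsKolyvaginPrime (W.conductorNorm ℤ) W K 2 ℓ → 2 ≤ Zhang2014.kolyvaginIndex W 2 ℓ →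
      (∃ (v : HeightOneSpectrum (𝓞 ℚ)) (𝔓 : Ideal (absIntegers (𝓞 ℚ) ℚ)) (h c₀ : absoluteGaloisGroup ℚ),
          (ℓ : 𝓞 ℚ) ∈ v.asIdeal ∧ 𝔓 ∈ v.primesAbove ∧ IsArithFrobAt (𝓞 ℚ) h 𝔓 ∧ IsComplexConjugation (Rat.castHom ℝ) c₀ ∧
          (∀ X : geomTorsion W ((2 : ℕ) : ℤ), h • h • X = X) ∧
          (∃ u : geomTorsion W ((2 : ℕ) : ℤ), h • u ≠ u) ∧
          ∀ (e : K →ₐ[ℚ] AlgebraicClosure ℚ) (z : K), h • e z = c₀ • e z) →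
      ∀ d : KolyvaginHeegnerData Dt β ι (1 * ℓ),
        ∃ Q : (W.baseChange (ringClassField K ι (1 * ℓ))).toAffine.Point, (2 : ℤ) • Q = d.derivedPoint)
    (M : ℕ) (s₀ : galH1Torsion W ((2 ^ M : ℕ) : ℤ)) (hs₀ : s₀ ∈ selmerGroup W ((2 ^ M : ℕ) : ℤ)) :
    ((2 ^ (M₀ - 1) : ℕ) : ℤ) • s₀ = 0 := by
  by_contra hne
  obtain ⟨ℓ, d, hkol, hidx, hfrob, -, -, hwit⟩ :=
    exists_transpositionDeep_primitive_of_two_pow_pred_smul_ne_zero hQ2 W hcm hT v h2v hNv hmult K hIQ hodd h3 hHe hsq1 hsq2 hρ Dt β ι d₁ M₀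
      hndiv hw1 M s₀ hs₀ hne
  exact hwit (hno ℓ hkol hidx hfrob d)

/-- **B2Q♭ for `Ш(E/ℚ)`**: on the multiplicative cut modulo Q2, a class `a ∈ Ш(E/ℚ)[2^∞]` with `2^{M₀−1} • a ≠ 0` (i.e. `Ш(E/ℚ)[2^∞]` of
exponent EXACTLY `2^{M₀}`, given B₂) yields a transposition-deep prime-level K₄-witness — via `Sel_(2^k)(E/ℚ) ↠ Ш(E/ℚ)[2^k]`
(`map_torsionH1ToH1_selmerGroup_holds`).  BSD is NOT proved by this. [cite: McCallumLMS1991, §5 Thm. 5.4] [cite: SilvermanAEC2009, Thm. X.4.2(a)] -/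
theorem kFourPos_shape_of_mem_sha_rat_of_two_pow_pred_smul_ne_zero (hQ2 : KolyvaginRelationAtTwo)
    (W : WeierstrassCurve ℚ) [W.IsElliptic] [W.IsGloballyMinimal] [NeZero (W.conductorNorm ℤ)] (hcm : ¬ W.HasCM)
    (hT : Odd W.tamagawaProduct) (v : HeightOneSpectrum (𝓞 ℚ)) (h2v : ((2 : ℕ) : 𝓞 ℚ) ∉ v.asIdeal)
    (hNv : ((W.conductorNorm ℤ : ℕ) : 𝓞 ℚ) ∈ v.asIdeal) (hmult : W.HasMultiplicativeReductionAt v)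
    (K : Type) [Field K] [NumberField K] (hIQ : IsImaginaryQuadratic K) (hodd : Odd (NumberField.discr K))
    (h3 : NumberField.discr K ≠ -3) (hHe : SatisfiesHeegnerHypothesis (W.conductorNorm ℤ) K)
    (hsq1 : ¬ IsSquare ((NumberField.discr K : ℚ) * -|W.Δ|)) (hsq2 : ¬ IsSquare ((NumberField.discr K : ℚ) * (-(2 * |W.Δ|))))
    (hρ : ∀ n : ℕ, 0 < n → W.HasSurjectiveModNGaloisRep ((2 : ℤ) ^ n))
    (Dt : ModularParametrizationData W (W.conductorNorm ℤ)) (β : ℤ) (ι : K →+* ℂ) (d₁ : KolyvaginHeegnerData Dt β ι 1) (M₀ : ℕ)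
    (hndiv : ¬ ∃ Q : (W.baseChange (ringClassField K ι 1)).toAffine.Point, ((2 ^ (M₀ + 1) : ℕ) : ℤ) • Q = d₁.derivedPoint)
    (hw1 : W.rootNumber = 1)
    (k : ℕ) (a : W.galH1) (ha : a ∈ W.sha) (hka : ((2 ^ k : ℕ) : ℤ) • a = 0) (hne : ((2 ^ (M₀ - 1) : ℕ) : ℤ) • a ≠ 0) :
    ∃ (n : ℕ) (d : KolyvaginHeegnerData Dt β ι n), Squarefree n ∧
      (∀ ℓ ∈ n.primeFactors, Zhang2014.IsKolyvaginPrime (W.conductorNorm ℤ) W K 2 ℓ ∧ 2 ≤ Zhang2014.kolyvaginIndex W 2 ℓ ∧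
        ∃ (v : HeightOneSpectrum (𝓞 ℚ)) (𝔓 : Ideal (absIntegers (𝓞 ℚ) ℚ)) (h : absoluteGaloisGroup ℚ),
          ((ℓ : ℕ) : 𝓞 ℚ) ∈ v.asIdeal ∧ 𝔓 ∈ v.primesAbove ∧ IsArithFrobAt (𝓞 ℚ) h 𝔓 ∧ ∃ u : W.geomTorsion ((2 : ℕ) : ℤ), h • u ≠ u) ∧
      ¬ ∃ Q : (W.baseChange (ringClassField K ι n)).toAffine.Point, (2 : ℤ) • Q = d.derivedPoint := by
  rcases Nat.eq_zero_or_pos k with rfl | hkpos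
  · rw [pow_zero, Nat.cast_one, one_zsmul] at hka
    exact (hne (by rw [hka, zsmul_zero])).elim
  · have hn : ((2 ^ k : ℕ) : ℤ) ≠ 0 := by positivity
    have hmem : a ∈ W.sha ⊓ torsionBy W.galH1 ((2 ^ k : ℕ) : ℤ) :=
      AddSubgroup.mem_inf.mpr ⟨ha, by change ((2 ^ k : ℕ) : ℤ) • a = 0; exact hka⟩
    rw [← WeierstrassCurve.map_torsionH1ToH1_selmerGroup_holds W hn] at hmem
    obtain ⟨x, hx, rfl⟩ := AddSubgroup.mem_map.mp hmem
    have hne' : ((2 ^ (M₀ - 1) : ℕ) : ℤ) • x ≠ 0 := fun h ↦ hne (by rw [← map_zsmul, h, map_zero])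
    exact kFourPos_shape_of_two_pow_pred_smul_ne_zero hQ2 W hcm hT v h2v hNv hmult K hIQ hodd h3 hHe hsq1 hsq2 hρ Dt β ι d₁ M₀ hndiv hw1
      ⟨k, x, hx, hne'⟩

end Summit.BirchSwinnertonDyer.BirchSwinnertonDyer.Theorems.GenusExact.PlusDescent

end
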